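import Mathlib
import HarnessLib
import Summits.HodgeConjecture.HodgeConjecture.Theorems.WeilTypeLadderCompactOrderingGreedy
import Summits.HodgeConjecture.HodgeConjecture.Theorems.WeilTypeLadderCompactOrderingWalls

/-!
# WeilTypeLadder · compact orderings III: THEOREM ORD — the criterion, for every `m` and every `N`

b2b cell `hweil` (packet `run/shared/lean/b2b/hodge-weil/`, report `b2b-hweil-pv3-g42/COMPACT-CRITERION.md`, prover 3
generation 42). PURE COMBINATORICS of `ZMod m`; no geometry, no named fact, no `decide`; supersedes the `N = 4` lemma of
`…CombPieces` and THEOREM ORD-6 (`…CyclicSexticOrderings`) and EXPLAINS the packet's OBSERVATION CO ([P3-g41] §5: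
369 904 / 369 904 connected `K`-Weil tuples with `m ≤ 24`, `N ≤ 8` are compactly orderable).

**THEOREM ORD** (`compactOrdering_iff_budget_le`). A list of non-zero residues mod `m` with sum `0` generating `ℤ/m` can
be re-ordered with all proper prefix sums non-zero **iff** for every unit `u`:
`m·#{i : βᵢ = u} + Σᵢ val(u⁻¹βᵢ) ≤ m(N+1)` (i.e. `#u + W_{u⁻¹} ≤ N + 1`). Existence half:
`exists_compactOrdering_of_budget_le` (strong induction on `N`: no majority letter ⟹ greedy lemma of part I; a majority
letter `g` is merged with some `y ∉ {g, -g}`, or the pair `{g, -g}` is removed, or `β = g^m`; the budgets are controlled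
by part II). Corollaries: `exists_compactOrdering_of_card_lt_two_mul` (FEWER THAN `2m` letters ⟹ always orderable) and
`not_compactOrdering_replicate_two_mul_one` (`1^{2m}` is not: the bound `2m` is sharp). CONSEQUENCE for the packet
(pen-and-paper there, via LEMMA F): if the units of `ℤ/m` are CHARGED for `K` (no prime `p ∣ m` splits in `K`) then
`K`-Weil ⟹ every unit budget `≤ m·N` ⟹ compactly orderable; if they are FREE (`(14, ℚ(√-7))`, `(20, ℚ(i))`,
`(21, ℚ(√-3))`, `(24, ℚ(√-2))`, …) then `1^{2m}` is a connected `K`-Weil tuple with NO compact ordering — so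
'K-Weil ⟹ compactly orderable' is false as a general statement and true below `N = 2m`.

HONEST LABEL: bookkeeping (combinatorics of rotation tuples); 0 rungs; nothing of Markman 2025 / Mostaed 2026 /
Perry 2026 is used; no kit job.
-/

-- every declaration of this problem lives in `Summit.HodgeConjecture.HodgeConjecture.…` (summit = sub-problem)
set_option linter.dupNamespace false

namespace Summit.HodgeConjecture.HodgeConjecture.WeilTypeLadder

open Multiset

section Sufficiency

variable {m : ℕ} [NeZero m]

/-- If every letter of a GENERATING multiset is a multiple of `g`, then `g` is a unit of `ℤ/m`. [folklore] -/
theorem isUnit_of_forall_mem_zmultiples (g : ZMod m) (β : Multiset (ZMod m))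
    (hgen : ∀ H : AddSubgroup (ZMod m), (∀ x ∈ β, x ∈ H) → H = ⊤)
    (h : ∀ x ∈ β, x ∈ AddSubgroup.zmultiples g) : IsUnit g := by
  have htop := hgen _ h
  have h1 : (1 : ZMod m) ∈ AddSubgroup.zmultiples g := by rw [htop]; exact AddSubgroup.mem_top 1
  obtain ⟨k, hk⟩ := AddSubgroup.mem_zmultiples_iff.mp h1
  rw [zsmul_eq_mul, mul_comm] at hk
  exact IsUnit.of_mul_eq_one _ hk

/-- **SUFFICIENCY (THEOREM ORD, existence half).** Let `β` be a multiset of NON-ZERO residues mod `m` with `Σ β = 0`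
which GENERATES `ℤ/m` (no proper subgroup contains all letters). If for every unit `u` the `u`-budget
`m·#{letters = u} + Σ_x val(u⁻¹x)` is at most `m(|β| + 1)` — i.e. `#u + W_{u⁻¹} ≤ N + 1`, `W` the winding number —,
then `β` has a COMPACT ORDERING (all proper prefix sums non-zero). Proof: strong induction on `|β|`; with no majority
letter the greedy lemma applies; a majority letter `g` is merged with a letter `y ∉ {g, -g}` (un-merged afterwards),
or the pair `{g, -g}` is removed (re-inserted behind the first letter), or `β = g^m`. [folklore] -/
theorem exists_compactOrdering_of_budget_le :
    ∀ (n : ℕ) (β : Multiset (ZMod m)), card β = n → (∀ x ∈ β, x ≠ 0) → β.sum = 0 →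
      (∀ H : AddSubgroup (ZMod m), (∀ x ∈ β, x ∈ H) → H = ⊤) →
      (∀ u : ZMod m, IsUnit u → m * β.count u + (β.map fun x => (u⁻¹ * x).val).sum ≤ m * (card β + 1)) →
      ∃ l : List (ZMod m), (l : Multiset (ZMod m)) = β ∧ ∀ k, 0 < k → k < l.length → (l.take k).sum ≠ 0 := by
  intro n
  induction n using Nat.strong_induction_on with
  | _ n ih =>
  intro β hn h0 hs hgen hcond
  have hmpos : 0 < m := Nat.pos_of_ne_zero (NeZero.ne m)
  by_cases hmaj : ∃ g, card β + 2 ≤ 2 * β.count g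
  swap
  · push Not at hmaj
    exact exists_compactOrdering_of_two_mul_count_le β h0 hs fun x => by have := hmaj x; omega
  obtain ⟨g, hg⟩ := hmaj
  have hgc : 2 ≤ β.count g := by have := count_le_card g β; omega
  have hgmem : g ∈ β := count_pos.mp (by omega)
  have hg0 : g ≠ 0 := h0 g hgmem
  -- no unit other than `g` is tight
  have hslack : ∀ u : ZMod m, IsUnit u → u ≠ g →
      m * β.count u + (β.map fun x => (u⁻¹ * x).val).sum ≤ m * card β := by
    intro u hu hug
    apply budget_le_of_not_majority u hu β h0 hs (hcond u hu)
    have := count_add_count_le_card β hug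
    omega
  by_cases hy : ∃ y ∈ β, y ≠ g ∧ g + y ≠ 0
  · -- MERGE `g, y ↦ g + y`
    obtain ⟨y, hymem, hyg, hgy⟩ := hy
    have hy0 : y ≠ 0 := h0 y hymem
    have hy' : y ∈ β.erase g := (mem_erase_of_ne hyg).mpr hymem
    obtain ⟨γ, rfl⟩ : ∃ γ, β = g ::ₘ y ::ₘ γ :=
      ⟨(β.erase g).erase y, by rw [cons_erase hy', cons_erase hgmem]⟩
    have hgγ : g ∈ γ := by
      have : (g ::ₘ y ::ₘ γ).count g = γ.count g + 1 := by simp [Ne.symm hyg]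
      exact count_pos.mp (by omega)
    have hcard : card (g ::ₘ y ::ₘ γ) = card γ + 2 := by simp
    set β' := (g + y) ::ₘ γ with hβ'
    have hn' : card β' = n - 1 := by rw [hβ', card_cons]; omega
    have h0' : ∀ x ∈ β', x ≠ 0 := by
      intro x hx
      rw [hβ', mem_cons] at hx
      rcases hx with rfl | hx
      · exact hgy
      · exact h0 x (by simp [hx])
    have hs' : β'.sum = 0 := by
      rw [hβ', sum_cons]
      rw [sum_cons, sum_cons, ← add_assoc] at hs
      exact hs
    have hgen' : ∀ H : AddSubgroup (ZMod m), (∀ x ∈ β', x ∈ H) → H = ⊤ := by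
      intro H hH
      apply hgen H
      have hgH : g ∈ H := hH g (by rw [hβ']; exact mem_cons_of_mem hgγ)
      have hgyH : g + y ∈ H := hH (g + y) (by rw [hβ']; exact mem_cons_self _ _)
      have hyH : y ∈ H := by have := H.sub_mem hgyH hgH; simpa using this
      intro x hx
      simp only [mem_cons] at hx
      rcases hx with rfl | rfl | hx
      · exact hgH
      · exact hyH
      · exact hH x (by rw [hβ']; exact mem_cons_of_mem hx)
    have hcond' : ∀ u : ZMod m, IsUnit u →
        m * β'.count u + (β'.map fun x => (u⁻¹ * x).val).sum ≤ m * (card β' + 1) := by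
      intro u hu
      have hb := budget_merge_le u hu g y γ hg0 hy0
      rw [hn', show n - 1 + 1 = n by omega]
      by_cases hug : u = g
      · subst hug
        simp only [if_true, mul_one] at hb
        have := hcond u hu
        rw [hn, Nat.mul_succ] at this
        rw [← hβ'] at hb
        omega
      · simp only [hug, if_false, mul_zero, add_zero] at hb
        have := hslack u hu hug
        rw [hn] at this
        rw [← hβ'] at hb
        omega
    obtain ⟨l', hl', hc'⟩ := ih (n - 1) (by omega) β' hn' h0' hs' hgen' hcond'
    have hmem : g + y ∈ l' := by rw [← mem_coe, hl', hβ']; exact mem_cons_self _ _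
    obtain ⟨P, R, rfl⟩ := List.append_of_mem hmem
    have hPR : (↑(P ++ R) : Multiset (ZMod m)) = γ := by
      rw [coe_append_cons, hβ'] at hl'
      exact (cons_inj_right _).mp hl'
    by_cases hPg : P.sum + g ≠ 0
    · refine ⟨P ++ g :: y :: R, ?_, compactOrdering_unmerge P R g y hc' hPg⟩
      rw [coe_append_cons, coe_append_cons, hPR]
    · have hPy : P.sum + y ≠ 0 := by
        intro h; push Not at hPg
        exact hyg (add_left_cancel (h.trans hPg.symm))
      have hc'' : ∀ k, 0 < k → k < (P ++ (y + g) :: R).length → ((P ++ (y + g) :: R).take k).sum ≠ 0 := by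
        rw [add_comm y g]; exact hc'
      refine ⟨P ++ y :: g :: R, ?_, compactOrdering_unmerge P R y g hc'' hPy⟩
      rw [coe_append_cons, coe_append_cons, hPR, cons_swap]
  · -- every letter is `g` or `-g`
    push Not at hy
    by_cases hng : -g ∈ β ∧ -g ≠ g
    · -- PAIR REMOVAL `{g, -g}`
      obtain ⟨hngmem, hngg⟩ := hng
      have hng' : -g ∈ β.erase g := (mem_erase_of_ne hngg).mpr hngmem
      obtain ⟨γ, rfl⟩ : ∃ γ, β = g ::ₘ (-g) ::ₘ γ :=
        ⟨(β.erase g).erase (-g), by rw [cons_erase hng', cons_erase hgmem]⟩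
      have hgγ : g ∈ γ := by
        have : (g ::ₘ (-g) ::ₘ γ).count g = γ.count g + 1 := by simp [Ne.symm hngg]
        exact count_pos.mp (by omega)
      have hcard : card (g ::ₘ (-g) ::ₘ γ) = card γ + 2 := by simp
      have hn' : card γ = n - 2 := by omega
      have h0' : ∀ x ∈ γ, x ≠ 0 := fun x hx => h0 x (by simp [hx])
      have hs' : γ.sum = 0 := by
        rw [sum_cons, sum_cons, ← add_assoc, add_neg_cancel, zero_add] at hs
        exact hs
      have hgen' : ∀ H : AddSubgroup (ZMod m), (∀ x ∈ γ, x ∈ H) → H = ⊤ := by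
        intro H hH
        apply hgen H
        have hgH : g ∈ H := hH g hgγ
        intro x hx
        simp only [mem_cons] at hx
        rcases hx with rfl | rfl | hx
        · exact hgH
        · exact H.neg_mem hgH
        · exact hH x hx
      have hcond' : ∀ u : ZMod m, IsUnit u →
          m * γ.count u + (γ.map fun x => (u⁻¹ * x).val).sum ≤ m * (card γ + 1) := by
        intro u hu
        have hb := budget_pair_le u hu g γ hg0
        rw [hn', show n - 2 + 1 = n - 1 by omega]
        by_cases hug : u = g
        · subst hug
          simp only [if_true, mul_one] at hb
          have := hcond u hu
          rw [hn, Nat.mul_succ] at this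
          have e : m * (n - 1) + m = m * n := by
            rw [← Nat.mul_succ]; congr 1; omega
          omega
        · simp only [hug, if_false, mul_zero, add_zero] at hb
          have := hslack u hu hug
          rw [hn] at this
          have e : m * (n - 1) + m = m * n := by
            rw [← Nat.mul_succ]; congr 1; omega
          omega
      obtain ⟨l', hl', hc'⟩ := ih (n - 2) (by omega) γ hn' h0' hs' hgen' hcond'
      have hne : l' ≠ [] := by
        rintro rfl
        rw [← hl'] at hgγ
        simp at hgγ
      obtain ⟨a, t, rfl⟩ := List.exists_cons_of_ne_nil hne
      have ha : a ≠ 0 := h0' a (by rw [← hl']; simp)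
      by_cases hag : a + g ≠ 0
      · refine ⟨a :: g :: (-g) :: t, ?_, compactOrdering_insert_pair a g t ha hag hc'⟩
        rw [← hl', ← cons_coe, ← cons_coe, ← cons_coe, ← cons_coe, cons_swap a g, cons_swap a (-g)]
      · have hag' : a + -g ≠ 0 := by
          push Not at hag
          have ha' : a = -g := eq_neg_of_add_eq_zero_left hag
          rw [ha', ← neg_add, neg_ne_zero]
          intro h
          exact hngg ((neg_eq_of_add_eq_zero_left h).symm ▸ rfl)
        refine ⟨a :: (-g) :: g :: t, ?_, by simpa using compactOrdering_insert_pair a (-g) t ha hag' hc'⟩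
        rw [← hl', ← cons_coe, ← cons_coe, ← cons_coe, ← cons_coe, cons_swap a (-g), cons_swap a g, cons_swap (-g) g]
    · -- BASE `β = g^n`, then `n = m`
      have hall : ∀ x ∈ β, x = g := by
        intro x hx
        by_contra hxg
        have hx' : x = -g := eq_neg_of_add_eq_zero_right (hy x hx hxg)
        exact hng ⟨hx' ▸ hx, fun h => hxg (hx'.trans h)⟩
      have hβ : β = replicate n g := eq_replicate.mpr ⟨hn, hall⟩
      have hunit : IsUnit g := isUnit_of_forall_mem_zmultiples g β hgen
        (fun x hx => by rw [hall x hx]; exact AddSubgroup.mem_zmultiples g)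
      haveI : Fact (1 < m) := ⟨one_lt_of_ne_zero hg0⟩
      have hcg := hcond g hunit
      rw [hβ, count_replicate_self, card_replicate, map_replicate, sum_replicate, ZMod.inv_mul_of_unit g hunit,
        ZMod.val_one, smul_eq_mul, mul_one, Nat.mul_succ] at hcg
      have hnm : n ≤ m := by omega
      have hsum : (n : ZMod m) * g = 0 := by rw [hβ, sum_replicate, nsmul_eq_mul] at hs; exact hs
      have hn0 : (n : ZMod m) = 0 := (hunit.mul_left_eq_zero).mp hsum
      have hmn : m ∣ n := (ZMod.natCast_eq_zero_iff n m).mp hn0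
      have hnpos : 0 < n := by have := count_le_card g β; omega
      have hnm' : n = m := le_antisymm hnm (Nat.le_of_dvd hnpos hmn)
      refine ⟨List.replicate n g, by rw [hβ]; exact coe_replicate n g, ?_⟩
      intro k hk hkl
      rw [List.length_replicate] at hkl
      rw [List.take_replicate, min_eq_left hkl.le, List.sum_replicate, nsmul_eq_mul]
      intro h
      have hk0 : (k : ZMod m) = 0 := (hunit.mul_left_eq_zero).mp h
      have := Nat.le_of_dvd hk ((ZMod.natCast_eq_zero_iff k m).mp hk0)
      omega

end Sufficiency

section Criterion

variable {m : ℕ} [NeZero m]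

/-- **THEOREM ORD (the criterion).** For a list `l` of NON-ZERO residues mod `m` with `Σ l = 0` generating `ℤ/m`:
`l` can be RE-ORDERED into a compact ordering (all proper prefix sums `≠ 0`) **iff** for every unit `u` of `ℤ/m`
`m·#{i : lᵢ = u} + Σᵢ val(u⁻¹ lᵢ) ≤ m(N + 1)`, i.e. `#u + W_{u⁻¹} ≤ N + 1` where `W_n = (1/m)Σᵢ rep(n lᵢ)` is the
winding number (`= D(n) + 1` in the packet's notation for cyclic covers of `ℙ¹`). [folklore] -/
theorem compactOrdering_iff_budget_le (l : List (ZMod m)) (h0 : ∀ x ∈ l, x ≠ 0) (hs : l.sum = 0)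
    (hgen : ∀ H : AddSubgroup (ZMod m), (∀ x ∈ l, x ∈ H) → H = ⊤) :
    (∃ l' : List (ZMod m), l'.Perm l ∧ ∀ k, 0 < k → k < l'.length → (l'.take k).sum ≠ 0) ↔
      ∀ u : ZMod m, IsUnit u → m * l.count u + (l.map fun x => (u⁻¹ * x).val).sum ≤ m * (l.length + 1) := by
  constructor
  · rintro ⟨l', hp, hc⟩ u hu
    have h0' : ∀ x ∈ l', x ≠ 0 := fun x hx => h0 x (hp.mem_iff.mp hx)
    have hs' : l'.sum = 0 := by rw [hp.sum_eq]; exact hs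
    have key := compactOrdering_budget_le l' h0' hs' hc u hu
    rwa [hp.count_eq, (hp.map _).sum_eq, hp.length_eq] at key
  · intro hcond
    have hcond' : ∀ u : ZMod m, IsUnit u →
        m * (l : Multiset (ZMod m)).count u + ((l : Multiset (ZMod m)).map fun x => (u⁻¹ * x).val).sum
          ≤ m * (card (l : Multiset (ZMod m)) + 1) := by
      intro u hu
      simpa using hcond u hu
    obtain ⟨l', hl', hc⟩ := exists_compactOrdering_of_budget_le l.length (l : Multiset (ZMod m)) (coe_card l)
      (fun x hx => h0 x (mem_coe.mp hx)) (by simpa using hs) (fun H hH => hgen H fun x hx => hH x (mem_coe.mpr hx))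
      hcond'
    exact ⟨l', coe_eq_coe.mp hl', hc⟩

/-- **COROLLARY (short tuples).** Every generating zero-sum multiset of non-zero residues mod `m` with FEWER THAN
`2m` letters has a compact ordering: the budget condition is automatic below `2m` (a violation needs a unit letter of
multiplicity `≥ N/2 + m`). [folklore] -/
theorem exists_compactOrdering_of_card_lt_two_mul (β : Multiset (ZMod m)) (h0 : ∀ x ∈ β, x ≠ 0)
    (hs : β.sum = 0) (hgen : ∀ H : AddSubgroup (ZMod m), (∀ x ∈ β, x ∈ H) → H = ⊤) (hN : card β < 2 * m) :
    ∃ l : List (ZMod m), (l : Multiset (ZMod m)) = β ∧ ∀ k, 0 < k → k < l.length → (l.take k).sum ≠ 0 := by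
  apply exists_compactOrdering_of_budget_le (card β) β rfl h0 hs hgen
  intro u hu
  have hmpos : 0 < m := Nat.pos_of_ne_zero (NeZero.ne m)
  obtain ⟨q, hq⟩ := dvd_sum_map_val_mul u⁻¹ β hs
  have hb := sum_map_val_add_le u hu β h0
  have hc := count_le_card u β
  rw [hq] at hb ⊢
  by_contra h
  push Not at h
  have h4 : card β + 2 ≤ β.count u + q := by
    have : m * (card β + 1) < m * (β.count u + q) := by rw [mul_add m (β.count u)]; exact h
    have := Nat.lt_of_mul_lt_mul_left this
    omega
  have h5 : m * (card β + 2) ≤ m * (β.count u + q) := Nat.mul_le_mul_left _ h4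
  obtain ⟨m', rfl⟩ : ∃ m', m = m' + 1 := ⟨m - 1, by omega⟩
  simp only [Nat.add_sub_cancel] at hb
  nlinarith [hb, h5, hc, hN]

/-- **SHARPNESS: `1^{2m}` has no compact ordering** (its `m`-th prefix sum is `m·1 = 0`), although it is zero-sum and
generating: the unit `1` has `#1 + W_1 = 2m + 2 > 2m + 1`. For `(m, K)` whose units are FREE for the Weil-type
condition (some prime `p ∣ m` splits in `K`: `(14, ℚ(√-7))`, `(20, ℚ(i))`, `(21, ℚ(√-3))`, `(24, ℚ(√-2))`, …) this tuple
is `K`-Weil and connected, so 'K-Weil ⟹ compactly orderable' is FALSE in general (report `b2b-hweil-pv3-g42`). [folklore] -/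
theorem not_compactOrdering_replicate_two_mul_one :
    ¬ ∀ k, 0 < k → k < (List.replicate (2 * m) (1 : ZMod m)).length →
        ((List.replicate (2 * m) (1 : ZMod m)).take k).sum ≠ 0 := by
  intro h
  have hmpos : 0 < m := Nat.pos_of_ne_zero (NeZero.ne m)
  apply h m hmpos (by rw [List.length_replicate]; omega)
  rw [List.take_replicate, min_eq_left (by omega), List.sum_replicate, nsmul_eq_mul, mul_one]
  exact ZMod.natCast_self m

end Criterion

end Summit.HodgeConjecture.HodgeConjecture.WeilTypeLadder
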